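/-
Copyright (c) 2026 the pub-hodgecm2 formalisation cell (harness21).  New file, outside the frozen port manifest.
Origin: seat `prover-pub-hodgecm2-d2bridge-prove-2-g6-0` (Δ2 BRIDGE; ι₁∕Id CHAIN, ASSEMBLER MODULE TABLE v1.2∕v1.3 row I7b-ENGINE, pen; «b» = d2bridge-wb-3;
engine census `HOME/d2bridge/iota1/I7b-PinSignatures/CENSUS-prove1.md` by d2bridge-prove-1 g6), 2026-08-24.  UNTWISTED twin of `B01/Transposition/Item6PlacementJunctionAppendixCGood.lean` §2–§3 (pin-3 ∕ item6-p2):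
`thm418Combined_of_thm418AsPrintedC_summands_pkg_of_goodId` (#8) and `…_records_of_goodId` (#7) — the Δ2 junction in summand form over the ported codes,
good characters only, over `C : Sec42Data (Model.honestP5IdOf h …) isotropicAt`.  Method (TABLE v1 «COPY + TOKEN FLIP»): statements and proofs VERBATIM, with the ONE token flip `Model.honestP5Of h ↦ Model.honestP5IdOf h`
(`X_K := M_K`, instlevel-a's ✔ `HComp/HonestP5Id.lean` p373641) and the theorem names suffixed `Id` (same namespaces as the originals); the datum enters these
statements only through `C.G ≡ ↥V.adelicFin` (`Model.honestP5IdOf_G`, `rfl`) and `P5.n = 3` (`rfl`), so no proof changes.  THEOREMS ONLY; no `def`, no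
instance, no named fact introduced, no `sorry`.  HC_CM is NOT proved; «Δ2 BRIDGE CLOSED» is NOT claimed.
-/
import Summits.HodgeConjecture.CorCM.B01.Transposition.Item6PlacementJunctionAppendixCGood
import Summits.HodgeConjecture.CorCM.B01.Transposition.HComp.HonestP5Id
import HarnessLib

/-!
# ι₁∕Id chain, I7b-ENGINE (1∕4): the good-characters Δ2 junction over the UNTWISTED datum

* `thm418Combined_of_thm418AsPrintedC_summands_pkg_of_goodId` (#8) — body: the tree's GENERIC `thm418Combined_of_realised_rankOne'_of_good` +
  `rankOne_inputs_of_asPrinted_summands` (group `↥V.adelicFin` by `rfl` at `honestP5IdOf`);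
* `thm418Combined_of_thm418AsPrintedC_summands_records_of_goodId` (#7) — the X1-records form (`Map43RationalData` read into `T.H` by `jH`).
References: [Liu2021] Thm. 4.18 (FJcycle.tex l. 2232–2245) with proof l. 2247–2268, Thm. 4.18 (1), Lem. 2.4 (1), Prop. 4.13 proof l. 2145, Def. 4.11,
App. D Lem. D.1 (1), §4.2, App. C Prop. C.5; [Deligne1979ShimuraVarieties] 2.2.5, Cor. 2.7.21.  HC_CM is NOT proved.
-/

set_option autoImplicit false

noncomputable section

open scoped DirectSum TensorProduct

namespace HodgeCM.Literature.Theta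

namespace LiuAlbaneseModuleDatum

open Summit.HodgeConjecture.CorCM
open Literature.AlgebraicGeometry.ShimuraVarieties.UnitaryCanonicalModel
open Literature.NumberTheory.Automorphic.Liu2021 Literature.NumberTheory.Automorphic.Liu2021.AppendixC NumberField
open MulAction

universe u v w

/-- **Δ2 IN ONE THEOREM, SUMMAND FORM, OVER THE PORTED CODES, GOOD CHARACTERS ONLY** — [Liu2021, Thm. 4.18] AS PRINTED at the
Appendix-C datum (one `Thm418Rest` per GOOD character) + per-summand identifications + the proof's realisation + the D-side printed
sentences at the good characters, and `block μ = ⊥` at the bad ones ⟹ `T.Thm418Combined res cmCl` (= `LiuDictionary.Thm418C` at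
`res := T'.res`, `cmCl := T'.cmClasses`).  KERNEL: per good `μ`, item6-p2's `rankOne_inputs_of_asPrinted_summands` at
`D := toThm418Data C (R μ hμ hg)` (group `↥V.adelicFin` by `rfl`) with the LEVEL binders discharged as in p313477
(`HodgeCM.Level.le_def`, `isOpen_K ∕ isCompact_K`, `pkgLevel_exists_K_le`); then §1.  HC_CM is NOT proved; no pin is discharged here.
[cite: Liu2021, Thm. 4.18 (FJcycle.tex l. 2232–2245) with proof l. 2247–2268, Thm. 4.18 (1) (l. 2239), Lem. 2.4 (1) (l. 1210–1213), Prop. 4.13 proof l. 2145, Def. 4.11, App. D Lem. D.1 (1), §4.2 l. 2053–2074, App. C l. 4618–4624, Prop. C.5 (l. 4624–4637)]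
[cite: Deligne1979ShimuraVarieties, 2.2.5 and Cor. 2.7.21] -/
theorem thm418Combined_of_thm418AsPrintedC_summands_pkg_of_goodId
    {L : HodgeCM.CMField} {ι₁ : L →+* ℂ} (V : HodgeCM.HermSpace3 L ι₁)
    (h : exists_recordSystem) (Φ : Literature.AlgebraicGeometry.Motives.CMType L)
    {isotropicAt : ℕ → Prop}
    (C : Sec42Data (Model.honestP5IdOf h ⟨L.K⟩ ι₁ ⟨V.Hm, V.isHermitian, V.signature_ι₁, V.posDef_of_ne⟩ Φ) isotropicAt)
    (T : LiuAlbaneseModuleDatum ↥V.adelicFin (HodgeCM.Level.K : HodgeCM.Level V → Subgroup ↥V.adelicFin))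
    {W : HodgeCM.Level V → Type w} [∀ K, AddCommGroup (W K)] [∀ K, Module ℂ (W K)]
    (res : ∀ K : HodgeCM.Level V, T.H →ₗ[ℂ] W K) (cmCl : ∀ K : HodgeCM.Level V, T.Char → Set (W K))
    (Good : T.Char → Prop) (hbad : ∀ μ : T.Char, T.PhiMu μ → ¬ Good μ → T.block μ = ⊥)
    (R : ∀ μ : T.Char, T.PhiMu μ → Good μ → Thm418Rest C)
    (hLiu : ∀ (μ : T.Char) (hμ : T.PhiMu μ) (hg : Good μ), Thm418AsPrintedC C (R μ hμ hg))
    (σ : ∀ (μ : T.Char) (hμ : T.PhiMu μ) (hg : Good μ), T.Adm μ → (toThm418Data C (R μ hμ hg)).AdmIndex)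
    (hσ : ∀ (μ : T.Char) (hμ : T.PhiMu μ) (hg : Good μ), Function.Injective (σ μ hμ hg))
    (e : ∀ (μ : T.Char) (hμ : T.PhiMu μ) (hg : Good μ) (a : T.Adm μ),
      T.Ω μ a ≃ₗ[ℂ] (toThm418Data C (R μ hμ hg)).omegaAt (σ μ hμ hg a))
    (he : ∀ (μ : T.Char) (hμ : T.PhiMu μ) (hg : Good μ) (a : T.Adm μ) (g : ↥V.adelicFin) (m : T.Ω μ a),
      e μ hμ hg a (MonoidAlgebra.of ℂ ↥V.adelicFin g • m) = (toThm418Data C (R μ hμ hg)).rhoAt (σ μ hμ hg a) g (e μ hμ hg a m))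
    (J : ∀ (μ : T.Char) (hμ : T.PhiMu μ) (hg : Good μ),
      ℂ ⊗[fieldOfValues L (toThm418Data C (R μ hμ hg)).μ] (toThm418Data C (R μ hμ hg)).Ω →ₗ[ℂ] T.H)
    (hJinj : ∀ (μ : T.Char) (hμ : T.PhiMu μ) (hg : Good μ), Function.Injective (J μ hμ hg))
    (hJ : ∀ (μ : T.Char) (hμ : T.PhiMu μ) (hg : Good μ) (g : ↥V.adelicFin)
      (x : ℂ ⊗[fieldOfValues L (toThm418Data C (R μ hμ hg)).μ] (toThm418Data C (R μ hμ hg)).Ω),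
      J μ hμ hg (((toThm418Data C (R μ hμ hg)).rhoΩ g).baseChange ℂ x) = MonoidAlgebra.of ℂ ↥V.adelicFin g • J μ hμ hg x)
    (Dμ : ∀ (μ : T.Char) (hμ : T.PhiMu μ) (hg : Good μ), (toThm418Data C (R μ hμ hg)).Obj)
    (hpin : ∀ (μ : T.Char) (hμ : T.PhiMu μ) (hg : Good μ) (K : HodgeCM.Level V)
      (φ : (toThm418Data C (R μ hμ hg)).HomK K.K (Dμ μ hμ hg)),
      res K (J μ hμ hg ((1 : ℂ) ⊗ₜ[fieldOfValues L (toThm418Data C (R μ hμ hg)).μ]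
        (toThm418Data C (R μ hμ hg)).res K.K (Dμ μ hμ hg) φ)) ∈ cmCl K μ)
    (hnvD : ∀ (μ : T.Char) (hμ : T.PhiMu μ) (hg : Good μ) (i : (toThm418Data C (R μ hμ hg)).AdmIndex),
      Nontrivial ((toThm418Data C (R μ hμ hg)).omegaAt i))
    (hmultD : ∀ (μ : T.Char) (hμ : T.PhiMu μ) (hg : Good μ) (i : (toThm418Data C (R μ hμ hg)).AdmIndex),
      Module.rank ℂ (Representation.IntertwiningMap ((toThm418Data C (R μ hμ hg)).rhoAt i)
        (Representation.ofModule' (k := ℂ) (G := ↥V.adelicFin) T.H)) ≤ 1) :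
    T.Thm418Combined res cmCl :=
  thm418Combined_of_realised_rankOne'_of_good Good hbad fun μ hμ hg =>
    rankOne_inputs_of_asPrinted_summands (toThm418Data C (R μ hμ hg)) (T := T) (hLiu μ hμ hg)
      (fun _ _ hle => HodgeCM.Level.le_def.mp hle) (fun Γ => ⟨Γ.isOpen_K, Γ.isCompact_K⟩)
      (Transposition.pkgLevel_exists_K_le V) (σ μ hμ hg) (hσ μ hμ hg)
      (e μ hμ hg) (he μ hμ hg) (J μ hμ hg) (hJinj μ hμ hg) (hJ μ hμ hg) (Dμ μ hμ hg) (hpin μ hμ hg) (hnvD μ hμ hg) fun i => by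
        letI : Module (MonoidAlgebra ℂ (toThm418Data C (R μ hμ hg)).G) T.H := T.instH₃
        haveI : IsScalarTower ℂ (MonoidAlgebra ℂ (toThm418Data C (R μ hμ hg)).G) T.H := T.instH₄
        exact (Thm418Data.rank_linearMap_asModule_le_rank_intertwiningMap_ofModule' (H := T.H) i).trans (hmultD μ hμ hg i)

/-- **Δ2 IN ONE THEOREM, SUMMAND FORM, OVER THE PORTED CODES AND THE X1 RECORDS, GOOD CHARACTERS ONLY** — as
`thm418Combined_of_thm418AsPrintedC_summands_records` (item6-p2) with every per-`μ` family asked only at the good characters and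
`block μ = ⊥` at the bad ones.  KERNEL: the X1 binders `J ∕ hJ ∕ hJinj ∕ Dμ ∕ hpin` of §2 are THEOREMS over the rational record
(`Map43RationalData.hJ ∕ injective_J ∕ J_tmul`, `finite_rat_L`) read through `jH`, exactly as in the records junction; then §2.
HC_CM is NOT proved; no pin is discharged here; nothing about Liu's objects is constructed.
[cite: Liu2021, Thm. 4.18 (FJcycle.tex l. 2232–2245) with proof l. 2247–2268 and map (4.3) l. 2250–2253, Thm. 4.18 (1) (l. 2239), Lem. 2.4 (1) (l. 1210–1213), Prop. 4.13 proof l. 2145, Def. 4.5 (2) (l. 1944–1952), Def. 4.11, App. D Lem. D.1 (1), §4.2 l. 2053–2081, App. C l. 4618–4624, Prop. C.5 (l. 4624–4637)]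
[cite: Deligne1979ShimuraVarieties, 2.2.5 and Cor. 2.7.21] -/
theorem thm418Combined_of_thm418AsPrintedC_summands_records_of_goodId
    {L : HodgeCM.CMField} {ι₁ : L →+* ℂ} (V : HodgeCM.HermSpace3 L ι₁)
    (h : exists_recordSystem) (Φ : Literature.AlgebraicGeometry.Motives.CMType L)
    {isotropicAt : ℕ → Prop}
    (C : Sec42Data (Model.honestP5IdOf h ⟨L.K⟩ ι₁ ⟨V.Hm, V.isHermitian, V.signature_ι₁, V.posDef_of_ne⟩ Φ) isotropicAt)
    (T : LiuAlbaneseModuleDatum ↥V.adelicFin (HodgeCM.Level.K : HodgeCM.Level V → Subgroup ↥V.adelicFin))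
    {W : HodgeCM.Level V → Type w} [∀ K, AddCommGroup (W K)] [∀ K, Module ℂ (W K)]
    (res : ∀ K : HodgeCM.Level V, T.H →ₗ[ℂ] W K) (cmCl : ∀ K : HodgeCM.Level V, T.Char → Set (W K))
    (Good : T.Char → Prop) (hbad : ∀ μ : T.Char, T.PhiMu μ → ¬ Good μ → T.block μ = ⊥)
    (R : ∀ μ : T.Char, T.PhiMu μ → Good μ → Thm418Rest C)
    (hLiu : ∀ (μ : T.Char) (hμ : T.PhiMu μ) (hg : Good μ), Thm418AsPrintedC C (R μ hμ hg))
    (σ : ∀ (μ : T.Char) (hμ : T.PhiMu μ) (hg : Good μ), T.Adm μ → (toThm418Data C (R μ hμ hg)).AdmIndex)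
    (hσ : ∀ (μ : T.Char) (hμ : T.PhiMu μ) (hg : Good μ), Function.Injective (σ μ hμ hg))
    (e : ∀ (μ : T.Char) (hμ : T.PhiMu μ) (hg : Good μ) (a : T.Adm μ),
      T.Ω μ a ≃ₗ[ℂ] (toThm418Data C (R μ hμ hg)).omegaAt (σ μ hμ hg a))
    (he : ∀ (μ : T.Char) (hμ : T.PhiMu μ) (hg : Good μ) (a : T.Adm μ) (g : ↥V.adelicFin) (m : T.Ω μ a),
      e μ hμ hg a (MonoidAlgebra.of ℂ ↥V.adelicFin g • m) = (toThm418Data C (R μ hμ hg)).rhoAt (σ μ hμ hg a) g (e μ hμ hg a m))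
    (M : ∀ (μ : T.Char) (hμ : T.PhiMu μ) (hg : Good μ), (toThm418Data C (R μ hμ hg)).Map43RationalData)
    (jH : ∀ (μ : T.Char) (hμ : T.PhiMu μ) (hg : Good μ), (M μ hμ hg).HB →ₗ[ℂ] T.H)
    (hjHinj : ∀ (μ : T.Char) (hμ : T.PhiMu μ) (hg : Good μ), Function.Injective (jH μ hμ hg))
    (hjH : ∀ (μ : T.Char) (hμ : T.PhiMu μ) (hg : Good μ) (g : ↥V.adelicFin) (x : (M μ hμ hg).HB),
      jH μ hμ hg ((M μ hμ hg).ρB g x) = MonoidAlgebra.of ℂ ↥V.adelicFin g • jH μ hμ hg x)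
    (hcm : ∀ (μ : T.Char) (hμ : T.PhiMu μ) (hg : Good μ) (K : HodgeCM.Level V)
      (φ : (toThm418Data C (R μ hμ hg)).HomK K.K (M μ hμ hg).Dμ),
      res K (jH μ hμ hg ((M μ hμ hg).ι
        (((M μ hμ hg).P ((toThm418Data C (R μ hμ hg)).res K.K (M μ hμ hg).Dμ φ)).baseChange ℂ (M μ hμ hg).α))) ∈ cmCl K μ)
    (hnvD : ∀ (μ : T.Char) (hμ : T.PhiMu μ) (hg : Good μ) (i : (toThm418Data C (R μ hμ hg)).AdmIndex),
      Nontrivial ((toThm418Data C (R μ hμ hg)).omegaAt i))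
    (hmultD : ∀ (μ : T.Char) (hμ : T.PhiMu μ) (hg : Good μ) (i : (toThm418Data C (R μ hμ hg)).AdmIndex),
      Module.rank ℂ (Representation.IntertwiningMap ((toThm418Data C (R μ hμ hg)).rhoAt i)
        (Representation.ofModule' (k := ℂ) (G := ↥V.adelicFin) T.H)) ≤ 1) :
    T.Thm418Combined res cmCl := by
  refine thm418Combined_of_thm418AsPrintedC_summands_pkg_of_goodId V h Φ C T res cmCl Good hbad R hLiu σ hσ e he
    (fun μ hμ hg => jH μ hμ hg ∘ₗ (M μ hμ hg).toMap43Data.J) ?_ ?_ (fun μ hμ hg => (M μ hμ hg).Dμ) ?_ hnvD hmultD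
  · -- (iii) «(4.3) is injective» (l. 2250–2268): a THEOREM over the rational record, then the injective reading `jH`
    intro μ hμ hg
    haveI := (M μ hμ hg).finite_rat_L
    exact (hjHinj μ hμ hg).comp (M μ hμ hg).injective_J
  · -- (ii) «`ℂ[𝔾(𝔸_F^∞)]`-linear» (l. 2250): `Map43RationalData.hJ`, then the equivariance of `jH`
    intro μ hμ hg g x
    show jH μ hμ hg ((M μ hμ hg).toMap43Data.J _) = _
    rw [(M μ hμ hg).hJ]
    exact hjH μ hμ hg g _
  · -- (C) the class identification THROUGH (4.3) at `z = 1` is the contract on Liu's own classes (`J_tmul`)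
    intro μ hμ hg K φ
    show res K (jH μ hμ hg ((M μ hμ hg).toMap43Data.J _)) ∈ _
    rw [(M μ hμ hg).J_tmul, one_smul]
    exact hcm μ hμ hg K φ

end LiuAlbaneseModuleDatum
end HodgeCM.Literature.Theta
end
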